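import Summits.Ventures.HSemireg.WedgeHankelRecurrencePeriodNodes
import Summits.Ventures.HSemireg.WedgeHankelRecurrencePeriodFinite
import Literature.FieldTheory.FiniteFields.BinomialFactorizationThreeModFourIrreducible

/-!
# Venture HSemireg — THE ORDER OF A PRODUCT OF DISTINCT LINEAR FACTORS: `ord(X − λ) = ord(λ)` and `ord(∏_i (X − λ_i)) = lcm_i ord(λ_i)` for distinct nodes (Lidl–Niederreiter Thm. 3.9 applied to
# linear factors), hence the dictionary between N85 (least period of `a/m` = `ord(m)`) and N89/N90 (periods of a sum of exponentials): **`secSeq A λ` is `T`-periodic iff `ord(∏ (X − λ_i)) ∣ T`;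
# over a finite field with non-zero distinct nodes and non-zero weights THE LEAST PERIOD IS `ord(∏ (X − λ_i))`, and `q − 1` is always a period**
# («a sum of `r` distinct non-zero geometric progressions over `F_q` is periodic with least period `lcm ord(λ_i) ∣ q − 1`»)

HONEST FRAMING. Part of the Lean index of the computation cell `pub-hsemireg` (seat p10 gen 31, Sunday typer «UNIFORM-IN-n»).
LINEAR ALGEBRA OF HANKEL (catalecticant) MATRICES and of polynomials over a field ONLY (`Lagrange.nodal`, `orderOf`, `FiniteField.pow_card_sub_one_eq_one`): no variety, no cohomology theory,
no sheaf, no Ext group and no semiregularity map is constructed here; nothing here says that HC / HC_CM / HC_AV holds.  No unproved named fact is used: the PROVED Literature module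
`Literature.Algebra.Polynomial.OrderOfPolynomial` (Lidl–Niederreiter, *Finite Fields*, Ch. 3: `polOrd`, `dvd_X_pow_sub_one_iff`, `polOrd_prod`) is imported (via N85), and `polOrd_X_sub_C`
(`ord(X − a) = orderOf a`, any field) is REUSED from the PROVED Literature module `Literature.FieldTheory.FiniteFields.BinomialFactorizationThreeModFourIrreducible` (Lidl–Niederreiter Thm. 3.76
discussion) — nothing of either is restated.
Custodian versions as in `WedgeHankelSiegelIdeal` (1/3).

WHAT IS IN THE TREE ∕ LINEAGE.  N84 (`WedgeHankelRecurrencePartialFractions`): `secSeq_eq_dualSeq_nodal`; N85 (`WedgeHankelRecurrencePeriodFinite`): `periodic_dualSeq_iff_polOrd_dvd`,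
`isLeast_setOf_periodic_dualSeq`; N89 (`WedgeHankelRecurrencePeriodNodes`): `isCoprime_nodal_sum_C_mul_nodal_erase`, `periodic_secSeq_iff`.  Mathlib: `Lagrange.nodal`, `Lagrange.nodal_monic`,
`Lagrange.eval_nodal`, `Polynomial.isCoprime_X_sub_C_of_isUnit_sub`, `FiniteField.pow_card_sub_one_eq_one`.
THIS FILE (namespace `Summit.Ventures.HSemireg.Wedge.HankelOuter` continued; CHAINED on N85 + N89; 0 definitions):
* §650 **`polOrd_nodal`** (nodes injective on `s`: `ord(nodal s λ) = s.lcm (orderOf ∘ λ)`), `polOrd_nodal_univ`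
  (`Fin r` form), `nodal_coeff_zero_ne_zero_iff` (`(nodal s λ)(0) ≠ 0 ↔` every node is non-zero), **`periodic_secSeq_iff_polOrd_nodal_dvd`** (distinct nodes, non-zero weights, any field:
  `secSeq A λ` is `T`-periodic `↔ ord(nodal λ) ∣ T`), **`isLeast_setOf_periodic_secSeq_polOrd`** (finite field, distinct NON-ZERO nodes, non-zero weights: the least positive period is
  `ord(nodal λ)` — N85 applied to N84's reduced symbol; equals N90's `lcm orderOf` by `polOrd_nodal_univ`), `periodic_secSeq_card_sub_one` (finite field with `q` elements, non-zero nodes, any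
  weights: `q − 1` is a period).
Nothing Ext-side.  New names only.
-/

open Module Polynomial
open scoped Matrix Polynomial

namespace Summit.Ventures.HSemireg.Wedge.HankelOuter

open Summit.Ventures.HSemireg.Wedge Summit.Ventures.HSemireg.Wedge.Hankel Summit.Ventures.HSemireg.Wedge.HankelSecant
open Literature.Algebra.Polynomial.OrderOfPolynomial

variable (K : Type*) [Field K]

/-! ## §650. The order of a product of distinct linear factors -/

/-- **`ord(∏_{i ∈ s} (X − λ_i)) = lcm_{i ∈ s} orderOf λ_i`** for nodes injective on `s` (the linear factors are pairwise coprime; Lidl–Niederreiter Thm. 3.9 `polOrd_prod` and `ord(X − λ) = orderOf λ` from the Literature). Any field. -/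
theorem polOrd_nodal {ι : Type*} (s : Finset ι) (lam : ι → K) (hinj : Set.InjOn lam s) : polOrd (Lagrange.nodal s lam) = s.lcm fun i => orderOf (lam i) := by
  rw [Lagrange.nodal, polOrd_prod s (fun i => Polynomial.X - C (lam i))]
  · exact Finset.lcm_congr rfl fun i _ => Literature.FieldTheory.FiniteFields.BinomialFactorizationThreeModFourIrreducible.polOrd_X_sub_C (lam i)
  · intro i hi j hj hij
    exact Polynomial.isCoprime_X_sub_C_of_isUnit_sub (sub_ne_zero.mpr fun h => hij (hinj hi hj h)).isUnit

/-- `Fin r` form: `ord(nodal λ) = lcm_i orderOf λ_i` for an injective family of nodes. -/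
theorem polOrd_nodal_univ {r : ℕ} (lam : Fin r → K) (hinj : Function.Injective lam) :
    polOrd (Lagrange.nodal Finset.univ lam) = Finset.univ.lcm fun i => orderOf (lam i) :=
  polOrd_nodal K Finset.univ lam hinj.injOn

/-- `(nodal s λ)(0) ≠ 0 ↔ ∀ i ∈ s, λ_i ≠ 0` (the constant coefficient is `∏ (−λ_i)`). Any field, any nodes. -/
theorem nodal_coeff_zero_ne_zero_iff {ι : Type*} (s : Finset ι) (lam : ι → K) : (Lagrange.nodal s lam).coeff 0 ≠ 0 ↔ ∀ i ∈ s, lam i ≠ 0 := by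
  rw [Polynomial.coeff_zero_eq_eval_zero, Lagrange.eval_nodal, Finset.prod_ne_zero_iff]
  simp only [zero_sub, neg_ne_zero]

/-- **`secSeq A λ` (distinct nodes, non-zero weights) is `T`-periodic iff `ord(nodal λ) ∣ T`** (any field): N84's symbol `(Σ_i C(A_i)·nodal (univ∖i) λ) / nodal λ` is reduced (N89), so N85
applies. -/
theorem periodic_secSeq_iff_polOrd_nodal_dvd {r : ℕ} (A lam : Fin r → K) (hinj : Function.Injective lam) (hA : ∀ i, A i ≠ 0) (T : ℕ) :
    Function.Periodic (secSeq K A lam) T ↔ polOrd (Lagrange.nodal Finset.univ lam) ∣ T := by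
  rw [secSeq_eq_dualSeq_nodal K A lam, periodic_dualSeq_iff_polOrd_dvd K Lagrange.nodal_monic (isCoprime_nodal_sum_C_mul_nodal_erase K Finset.univ lam A hinj.injOn fun i _ => hA i)]

/-- **OVER A FINITE FIELD THE LEAST PERIOD OF A SUM OF EXPONENTIALS WITH DISTINCT NON-ZERO NODES AND NON-ZERO WEIGHTS IS `ord(nodal λ) = lcm_i ord(λ_i)`** (N85's `isLeast_setOf_periodic_dualSeq`
for the reduced symbol of N84; `(nodal λ)(0) ≠ 0` because no node vanishes). -/
theorem isLeast_setOf_periodic_secSeq_polOrd [Finite K] {r : ℕ} (A lam : Fin r → K) (hinj : Function.Injective lam) (hA : ∀ i, A i ≠ 0) (hlam : ∀ i, lam i ≠ 0) :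
    IsLeast {T : ℕ | 0 < T ∧ Function.Periodic (secSeq K A lam) T} (polOrd (Lagrange.nodal Finset.univ lam)) := by
  rw [secSeq_eq_dualSeq_nodal K A lam]
  exact isLeast_setOf_periodic_dualSeq K Lagrange.nodal_monic (isCoprime_nodal_sum_C_mul_nodal_erase K Finset.univ lam A hinj.injOn fun i _ => hA i)
    ((nodal_coeff_zero_ne_zero_iff K Finset.univ lam).mpr fun i _ => hlam i)

/-- **over a finite field with `q` elements, `q − 1` is a period of every sum of exponentials with non-zero nodes** (any weights, nodes not necessarily distinct: `λ^{q−1} = 1`). -/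
theorem periodic_secSeq_card_sub_one [Fintype K] {r : ℕ} (A lam : Fin r → K) (hlam : ∀ i, lam i ≠ 0) : Function.Periodic (secSeq K A lam) (Fintype.card K - 1) := by
  intro j
  simp only [secSeq, pow_add, FiniteField.pow_card_sub_one_eq_one _ (hlam _), mul_one]

end Summit.Ventures.HSemireg.Wedge.HankelOuter
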